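import Literature.AlgebraicGeometry.Frobenioids.BirationalizationBiratData
import Literature.AlgebraicGeometry.Frobenioids.RigiditySlimness
import Literature.AlgebraicGeometry.Frobenioids.EquivalenceUnitsTransport
import HarnessLib

/-!
# Frobenioids I, Corollary 4.10 — the rigidity clause: `C → C^birat` is rigid for `D` slim and `C` of
# birationally Frobenius-normalized type; and `C^birat` is totally epimorphic

Mochizuki, *The geometry of Frobenioids I: the general theory*, Kyushu J. Math. **62** (2008)
293–400, Cor. 4.10, kurims text p. 91 [cite: MochizukiFrdI2008, Cor. 4.10 p.91]: "Finally, if `D₁`,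
`D₂` are slim, and `C₁`, `C₂` are of birationally Frobenius-normalized type, then each of the composite
functors of this diagram is rigid. … The rigidity assertion then follows immediately from Proposition
1.13, (i), by considering base-identity endomorphisms of Frobenius type of Frobenius-trivial objects of
`C_i`, under the hypothesis that the `C_i` are birationally Frobenius-normalized."

PROOF-ONLY file (seat abc-iut-L1-t10 gen 2, piece FrdI:Cor4.10 under abc-iut-L1-t14's row; no new
notions) over THE birationalization `C → C^birat` of seats abc-iut-L6-t8 / L6-t6
(`Birationalization*.lean`, `BiratLocalizationUniversal.lean`, `BirationalizationBiratData.lean`):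

* `Birat.epi_toBirat_map` — every `C → C^birat`-image of an arrow of `C` is an EPIMORPHISM of `C^birat`
  (pre-steps are monomorphisms, Def. 1.3 (v)(a); `C` is totally epimorphic; the colimit relation of
  Prop. 4.4 (i)); `Birat.mono_toBirat_map_of_mono` — the image of a monomorphism is a monomorphism;
  `Birat.epi` — hence EVERY arrow of `C^birat` is an epimorphism ("`C^birat` is totally epimorphic",
  part of Prop. 4.4 (ii) "`C^birat` is a Frobenioid");
* `Birat.base_map_app_eq_id` — for `D` slim, the components of an automorphism of `C → C^birat` are
  base-identity (Prop. 1.13 (i) for `C → D`, seat abc-iut-L1-t1, through `C → C^birat → D ≅ C → D`);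
* `Birat.app_eq_id_of_isFrobeniusTrivial` — … and trivial at Frobenius-trivial objects when `C` is of
  birationally Frobenius-normalized type (naturality along a base-identity endomorphism of Frobenius
  degree `2`, Frobenius-normalization, and `Birat.epi_toBirat_map`);
* `isRigidFunctor_toBirat` — **`C → C^birat` is rigid** for `D` slim and `C` of birationally
  Frobenius-normalized type (Def. 1.3 (i)(a)(b): every object is reached from a Frobenius-trivial one
  through a span of pre-steps; mono/epi cancellation in `C^birat`).

With `cor410_biratData_of_isRigid` (`BirationalizationCategoryTheoreticity.lean`) this discharges the
typed Cor. 4.10 at the birationalizations modulo only Thm. 3.4 (ii) ("`Ψ` preserves co-angular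
pre-steps"). No statement of the paper is restated or strengthened.
-/

namespace Literature.AlgebraicGeometry.Frobenioids

open CategoryTheory Opposite

universe w v v' u u'

namespace PreFrobenioid

variable {D : Type u} [Category.{v} D] {Φ : Dᵒᵖ ⥤ CommMonCat.{w}}
  {C : Type u'} [Category.{v'} C] {F : C ⥤ ElemFrobenioid Φ}
  {hF : IsFrobenioid F} {hsq : HasBiratSquares F}

namespace Birat

/-! ### Epimorphisms and monomorphisms of `C^birat` coming from `C` -/

/-- **Every arrow `C → C^birat`-image is an epimorphism of `C^birat`.** If `[φ] ≫ g₁ = [φ] ≫ g₂` with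
`g_i = [(t, h_i)]` over a common co-angular pre-step `t`, compute both composites with ONE square
`α' ≫ φ = φ'' ≫ t`; equality in the colimit gives co-angular pre-steps `ε, ε'` with `ε ≫ α' = ε' ≫ α'`
— so `ε = ε'`, pre-steps being monomorphisms (Def. 1.3 (v)(a)) — and `ε ≫ φ'' ≫ h₁ = ε ≫ φ'' ≫ h₂`, so
`h₁ = h₂`, `C` being totally epimorphic. [cite: MochizukiFrdI2008, Prop. 4.4 (ii) p.83] -/
theorem epi_toBirat_map (hF : IsFrobenioid F) (hsq : HasBiratSquares F) {A B : C} (φ : A ⟶ B) :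
    Epi ((toBirat F hF hsq).map φ) := by
  refine ⟨fun {Z} g₁ g₂ h => ?_⟩
  obtain ⟨f₁, rfl⟩ := homMk_surjective g₁
  obtain ⟨f₂, rfl⟩ := homMk_surjective g₂
  -- common denominator `t := κ ≫ t₁ = κ' ≫ t₂`
  obtain ⟨T, κ, κ', hκ, hκ', hT⟩ := exists_common_refinement hF f₁.den f₂.den f₁.den_mem f₂.den_mem
  let k₁ : BiratFrac F B Z.out := ⟨T, κ ≫ f₁.den, κ ≫ f₁.num, hκ.comp hF f₁.den_mem⟩
  let k₂ : BiratFrac F B Z.out := ⟨T, κ' ≫ f₂.den, κ' ≫ f₂.num, hκ'.comp hF f₂.den_mem⟩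
  have hk₁ : (homMk f₁ : (toBirat F hF hsq).obj B ⟶ Z) = homMk k₁ :=
    (homMk_sound (BiratFrac.rel_restrict hF f₁ κ hκ)).symm
  have hk₂ : (homMk f₂ : (toBirat F hF hsq).obj B ⟶ Z) = homMk k₂ :=
    (homMk_sound (BiratFrac.rel_restrict hF f₂ κ' hκ')).symm
  rw [hk₁, hk₂] at h ⊢
  -- one square for `φ` along the common denominator
  obtain ⟨X', α', φ'', hα', hw⟩ := hsq φ (κ ≫ f₁.den) (hκ.comp hF f₁.den_mem)
  let S₁ : BiratFrac.Square (BiratFrac.ofHom hF φ) k₁ :=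
    { apex := X', left := α', right := φ'', left_mem := hα', w := hw }
  let S₂ : BiratFrac.Square (BiratFrac.ofHom hF φ) k₂ :=
    { apex := X', left := α', right := φ'', left_mem := hα'
      w := by
        change α' ≫ φ = φ'' ≫ κ' ≫ f₂.den
        rw [← hT]
        exact hw }
  have e₁ := homMk_comp_homMk_eq (X := (toBirat F hF hsq).obj A) (Y := (toBirat F hF hsq).obj B)
    (Z := Z) (BiratFrac.ofHom hF φ) k₁ S₁
  have e₂ := homMk_comp_homMk_eq (X := (toBirat F hF hsq).obj A) (Y := (toBirat F hF hsq).obj B)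
    (Z := Z) (BiratFrac.ofHom hF φ) k₂ S₂
  have h' : (homMk (BiratFrac.compWith hF (BiratFrac.ofHom hF φ) k₁ S₁) :
        (toBirat F hF hsq).obj A ⟶ Z) =
      homMk (BiratFrac.compWith hF (BiratFrac.ofHom hF φ) k₂ S₂) :=
    (e₁.symm.trans h).trans e₂
  obtain ⟨E, ε, ε', hε, -, h₁, h₂⟩ := homMk_eq_homMk_iff.mp h'
  -- `ε ≫ α' = ε' ≫ α'` with `α'` a monomorphism
  have h₁' : ε ≫ α' = ε' ≫ α' := by
    have h₁'' : ε ≫ α' ≫ 𝟙 A = ε' ≫ α' ≫ 𝟙 A := h₁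
    simpa only [Category.comp_id] using h₁''
  haveI : Mono α' := hF.v_a α' hα'.2
  have hεε : ε = ε' := (cancel_mono α').mp h₁'
  subst hεε
  -- `(ε ≫ φ'') ≫ κ ≫ h₁ = (ε ≫ φ'') ≫ κ' ≫ h₂` with `ε ≫ φ''` an epimorphism
  have h₂' : (ε ≫ φ'') ≫ κ ≫ f₁.num = (ε ≫ φ'') ≫ κ' ≫ f₂.num := by
    have h₂'' : ε ≫ φ'' ≫ κ ≫ f₁.num = ε ≫ φ'' ≫ κ' ≫ f₂.num := h₂
    simpa only [Category.assoc] using h₂''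
  haveI : Epi (ε ≫ φ'') := hF.isPreFrobenioid.isTotallyEpimorphic.epi _
  have hnum : κ ≫ f₁.num = κ' ≫ f₂.num := (cancel_epi (ε ≫ φ'')).mp h₂'
  exact homMk_sound ⟨T, 𝟙 _, 𝟙 _, isCoAngularPreStep_id hF _, isCoAngularPreStep_id hF _,
    by change 𝟙 T ≫ κ ≫ f₁.den = 𝟙 T ≫ κ' ≫ f₂.den; rw [hT],
    by change 𝟙 T ≫ κ ≫ f₁.num = 𝟙 T ≫ κ' ≫ f₂.num; rw [hnum]⟩

/-- The `C → C^birat`-image of a MONOMORPHISM of `C` (e.g. of a pre-step, Def. 1.3 (v)(a)) is a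
monomorphism of `C^birat`. [cite: MochizukiFrdI2008, Prop. 4.4 (ii) p.83] -/
theorem mono_toBirat_map_of_mono (hF : IsFrobenioid F) (hsq : HasBiratSquares F) {A B : C}
    (φ : A ⟶ B) [Mono φ] : Mono ((toBirat F hF hsq).map φ) := by
  refine ⟨fun {W} g₁ g₂ h => ?_⟩
  obtain ⟨f₁, rfl⟩ := homMk_surjective g₁
  obtain ⟨f₂, rfl⟩ := homMk_surjective g₂
  let S₁ : BiratFrac.Square f₁ (BiratFrac.ofHom hF φ) :=
    { apex := f₁.src, left := 𝟙 _, right := f₁.num, left_mem := isCoAngularPreStep_id hF _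
      w := by
        change 𝟙 _ ≫ f₁.num = f₁.num ≫ 𝟙 _
        exact (Category.id_comp _).trans (Category.comp_id _).symm }
  let S₂ : BiratFrac.Square f₂ (BiratFrac.ofHom hF φ) :=
    { apex := f₂.src, left := 𝟙 _, right := f₂.num, left_mem := isCoAngularPreStep_id hF _
      w := by
        change 𝟙 _ ≫ f₂.num = f₂.num ≫ 𝟙 _
        exact (Category.id_comp _).trans (Category.comp_id _).symm }
  have e₁ := homMk_comp_homMk_eq (X := W) (Y := (toBirat F hF hsq).obj A)
    (Z := (toBirat F hF hsq).obj B) f₁ (BiratFrac.ofHom hF φ) S₁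
  have e₂ := homMk_comp_homMk_eq (X := W) (Y := (toBirat F hF hsq).obj A)
    (Z := (toBirat F hF hsq).obj B) f₂ (BiratFrac.ofHom hF φ) S₂
  have h' : (homMk (BiratFrac.compWith hF f₁ (BiratFrac.ofHom hF φ) S₁) :
        W ⟶ (toBirat F hF hsq).obj B) =
      homMk (BiratFrac.compWith hF f₂ (BiratFrac.ofHom hF φ) S₂) :=
    (e₁.symm.trans h).trans e₂
  obtain ⟨E, ε, ε', hε, hε', h₁, h₂⟩ := homMk_eq_homMk_iff.mp h'
  have h₁' : ε ≫ f₁.den = ε' ≫ f₂.den := by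
    have h₁'' : ε ≫ 𝟙 _ ≫ f₁.den = ε' ≫ 𝟙 _ ≫ f₂.den := h₁
    simpa only [Category.id_comp] using h₁''
  have h₂' : (ε ≫ f₁.num) ≫ φ = (ε' ≫ f₂.num) ≫ φ := by
    have h₂'' : ε ≫ f₁.num ≫ φ = ε' ≫ f₂.num ≫ φ := h₂
    simpa only [Category.assoc] using h₂''
  exact homMk_sound ⟨E, ε, ε', hε, hε', h₁', (cancel_mono φ).mp h₂'⟩

/-- **`C^birat` is totally epimorphic**: every arrow `[(α, φ')]` of `C^birat` is an epimorphism, since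
`[α] ≫ [(α, φ')] = [φ']` with `[φ']` an epimorphism. [cite: MochizukiFrdI2008, Prop. 4.4 (ii) p.83] -/
theorem epi (hF : IsFrobenioid F) (hsq : HasBiratSquares F) {X Z : Birat F hF hsq} (g : X ⟶ Z) :
    Epi g := by
  obtain ⟨f, rfl⟩ := homMk_surjective g
  refine ⟨fun {W} g₁ g₂ h => ?_⟩
  haveI : Epi ((toBirat F hF hsq).map f.num) := epi_toBirat_map hF hsq f.num
  refine (cancel_epi ((toBirat F hF hsq).map f.num)).mp ?_
  have hden := toBirat_map_den_comp_homMk hF hsq f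
  have h' : (homMk f : (toBirat F hF hsq).obj X.out ⟶ (toBirat F hF hsq).obj Z.out) ≫ g₁ =
      (homMk f : (toBirat F hF hsq).obj X.out ⟶ (toBirat F hF hsq).obj Z.out) ≫ g₂ := h
  rw [← hden, Category.assoc, Category.assoc]
  exact congrArg (fun t => (toBirat F hF hsq).map f.den ≫ t) h'

/-! ### Automorphisms of `C → C^birat`: base-identity components -/

/-- For `D` slim: the components of an automorphism `α` of the functor `C → C^birat` are base-identity
endomorphisms of `C^birat → F_{0_D}`: `α` induces, through `C → C^birat → D ≅ C → D`, an automorphism of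
`C → D`, trivial by Prop. 1.13 (i). [cite: MochizukiFrdI2008, Cor. 4.10 p.91] -/
theorem base_map_app_eq_id (hF : IsFrobenioid F) (hsq : HasBiratSquares F) (hD : IsSlim D)
    (α : toBirat F hF hsq ≅ toBirat F hF hsq) (A : C) :
    (biratOps hF hsq).base.map (α.hom.app A) = 𝟙 _ := by
  -- the iso `e : Base^birat(A^birat) ≅ A_D` and the induced automorphism `β` of `C → D`
  have hety : ∃ e : (biratOps hF hsq).base.obj ((toBirat F hF hsq).obj A) ≅ baseObj F A,
      e = (biratOverBase hF hsq).app A := ⟨_, rfl⟩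
  obtain ⟨e, he⟩ := hety
  let β : PreFrobenioid.baseFunctor F ≅ PreFrobenioid.baseFunctor F :=
    (biratOverBase hF hsq).symm ≪≫ Functor.isoWhiskerRight α (biratOps hF hsq).base ≪≫ biratOverBase hF hsq
  have hβ : β = Iso.refl _ := isRigidFunctor_baseFunctor hF hD β
  have hβA : e.inv ≫ (biratOps hF hsq).base.map (α.hom.app A) ≫ e.hom = 𝟙 _ := by
    have h := congrArg (fun i : PreFrobenioid.baseFunctor F ≅ PreFrobenioid.baseFunctor F => i.hom.app A) hβ
    rw [he]
    exact h
  have h2 : (biratOps hF hsq).base.map (α.hom.app A) ≫ e.hom = e.hom := by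
    have := e.inv_comp_eq.mp hβA
    rw [Category.comp_id] at this
    exact this
  exact (cancel_mono e.hom).mp (h2.trans (Category.id_comp _).symm)

/-- The components of an automorphism of `C → C^birat` lie in `O^▷(A^birat)` (base-identity and
linear) when `D` is slim. [cite: MochizukiFrdI2008, Cor. 4.10 p.91] -/
theorem app_mem_endSubmonoid (hF : IsFrobenioid F) (hsq : HasBiratSquares F) (hD : IsSlim D)
    (α : toBirat F hF hsq ≅ toBirat F hF hsq) (A : C) :
    (α.hom.app A : End ((toBirat F hF hsq).obj A)) ∈
      (biratOps hF hsq).endSubmonoid ((toBirat F hF hsq).obj A) :=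
  ⟨base_map_app_eq_id hF hsq hD α A, degFr_iso_hom (toElemZero hF hsq) (α.app A)⟩

/-! ### Triviality at Frobenius-trivial objects, then everywhere -/

/-- At a FROBENIUS-TRIVIAL object `A` of a Frobenioid of birationally Frobenius-normalized type (and
`D` slim), an automorphism `α` of `C → C^birat` has trivial component: with `ζ₂` the base-identity
endomorphism of Frobenius degree `2` of `A`, naturality gives `[ζ₂] ≫ α_A = α_A ≫ [ζ₂]`, Frobenius
normalization of `A^birat` gives `α_A ≫ [ζ₂] = [ζ₂] ≫ α_A²`, and `[ζ₂]` is an epimorphism, so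
`α_A = α_A²`, `α_A = id` ("by considering base-identity endomorphisms of Frobenius type of
Frobenius-trivial objects", p. 91). [cite: MochizukiFrdI2008, Cor. 4.10 p.91] -/
theorem app_eq_id_of_isFrobeniusTrivial (hF : IsFrobenioid F) (hsq : HasBiratSquares F) (hD : IsSlim D)
    (hN : PreFrobenioidData.IsOfBiratFrobeniusNormalizedType (biratData hF hsq))
    (α : toBirat F hF hsq ≅ toBirat F hF hsq) {A : C} (hA : IsFrobeniusTrivial F A) :
    α.hom.app A = 𝟙 _ := by
  obtain ⟨ζ, hζ⟩ := hA
  obtain ⟨hdeg, hbid, -⟩ := hζ 2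
  -- names with their types spelled out (as endomorphisms of `A^birat`)
  have huty : ∃ u : End ((toBirat F hF hsq).obj A), u = α.hom.app A := ⟨_, rfl⟩
  obtain ⟨u, hu⟩ := huty
  have hpty : ∃ p : End ((toBirat F hF hsq).obj A), p = (toBirat F hF hsq).map (ζ 2) := ⟨_, rfl⟩
  obtain ⟨p, hp⟩ := hpty
  -- naturality: `u * p = p * u` (`End` multiplication is composition)
  have hnat : u * p = p * u := by
    rw [hu, hp]
    exact α.hom.naturality (ζ 2)
  -- Frobenius normalization of `A^birat`: `u ^ deg(p) * p = p * u`
  have hbfn : (biratOps hF hsq).IsFrobeniusNormalized ((toBirat F hF hsq).obj A) := hN.obj A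
  have hpbase : (biratOps hF hsq).IsBaseIdentity p := by
    change (biratOps hF hsq).base.map p = 𝟙 _
    rw [hp, biratOps_base_map_toBirat]
    exact hbid
  have hpdeg : ((biratOps hF hsq).degFr p : ℕ) = 2 := by
    rw [hp, biratOps_degFr_toBirat]
    exact congrArg PNat.val hdeg
  have humem : u ∈ (biratOps hF hsq).endSubmonoid ((toBirat F hF hsq).obj A) := by
    rw [hu]
    exact app_mem_endSubmonoid hF hsq hD α A
  have hnorm : u ^ ((biratOps hF hsq).degFr p : ℕ) * p = p * u := hbfn p hpbase u humem
  rw [hpdeg, pow_two] at hnorm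
  -- `(u * u) * p = u * p`, i.e. `p ≫ (u ≫ u) = p ≫ u`; cancel the epimorphism `p = [ζ₂]`
  have huu : u * u * p = u * p := hnorm.trans hnat.symm
  have hepi : Epi (show (toBirat F hF hsq).obj A ⟶ (toBirat F hF hsq).obj A from p) := by
    rw [hp]
    exact epi_toBirat_map hF hsq (ζ 2)
  have hu2 : u * u = u :=
    (@cancel_epi _ _ _ _ _ (show (toBirat F hF hsq).obj A ⟶ (toBirat F hF hsq).obj A from p) hepi
      _ _).mp huu
  -- `u` is an isomorphism with `u ≫ u = u`, so `u = id`
  subst hu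
  exact (cancel_epi (α.hom.app A)).mp (hu2.trans (Category.comp_id _).symm)

end Birat

/-- **Cor. 4.10, rigidity: `C → C^birat` is rigid** for a Frobenioid `C` of birationally
Frobenius-normalized type over a slim base `D` (FrdI p. 91: "follows immediately from Proposition 1.13,
(i), by considering base-identity endomorphisms of Frobenius type of Frobenius-trivial objects").
Reduction to Frobenius-trivial objects: by Def. 1.3 (i)(a)(b) every `A` is the target of a pre-step
`ψ : X → A` from the source of a pre-step `φ : X → A₀` with `A₀` Frobenius-trivial; `[φ]` is a
monomorphism and `[ψ]` an epimorphism of `C^birat`, so `α_{A₀} = id ⇒ α_X = id ⇒ α_A = id`.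
[cite: MochizukiFrdI2008, Cor. 4.10 p.91] -/
theorem isRigidFunctor_toBirat (hF : IsFrobenioid F) (hsq : HasBiratSquares F) (hD : IsSlim D)
    (hN : PreFrobenioidData.IsOfBiratFrobeniusNormalizedType (biratData hF hsq)) :
    IsRigidFunctor (toBirat F hF hsq) := by
  intro α
  ext A
  change α.hom.app A = 𝟙 _
  -- a Frobenius-trivial `A₀` over `A_D` and a span of pre-steps `A₀ ← X → A`
  obtain ⟨A₀, hA₀, ⟨e⟩⟩ := hF.i_a (baseObj F A)
  obtain ⟨X, φ, ψ, hφ, -, -⟩ := hF.i_b A₀ A e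
  have h₀ : α.hom.app A₀ = 𝟙 _ := Birat.app_eq_id_of_isFrobeniusTrivial hF hsq hD hN α hA₀
  -- `α_X = id`: naturality at the pre-step `φ`, a monomorphism in `C` and in `C^birat`
  haveI : Mono φ := hF.v_a φ hφ
  haveI : Mono ((toBirat F hF hsq).map φ) := Birat.mono_toBirat_map_of_mono hF hsq φ
  have hX : α.hom.app X = 𝟙 _ := by
    have hn := α.hom.naturality φ
    rw [h₀, Category.comp_id] at hn
    exact (cancel_mono ((toBirat F hF hsq).map φ)).mp (hn.symm.trans (Category.id_comp _).symm)
  -- `α_A = id`: naturality at `ψ`, an epimorphism in `C^birat`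
  haveI : Epi ((toBirat F hF hsq).map ψ) := Birat.epi_toBirat_map hF hsq ψ
  have hn := α.hom.naturality ψ
  rw [hX, Category.id_comp] at hn
  exact (cancel_epi ((toBirat F hF hsq).map ψ)).mp (hn.trans (Category.comp_id _).symm)

end PreFrobenioid

end Literature.AlgebraicGeometry.Frobenioids
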